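import Summits.ResolutionOfSingularities.ResolutionOfSingularities.Theses.WildQuotients
import Literature.AlgebraicGeometry.Resolution.RegularLocalRingsNormal

/-!
# `WildQuotientResolution` — negative lemmas I(a): the cusp algebra `k[T², T³]`

Support (negative) lemmas for crux `stmt-ResolutionOfSingularities-15640`
(`Summit.ResolutionOfSingularities.ResolutionOfSingularities.Theses.WildQuotients.WildQuotientResolution`),
filed by the standing disprover (cdisprove gen 1; work file
`Cruxes/WildQuotientResolution/Disproof.lean`): the commutative algebra behind the cusp model of
`Negative/CuspModel.lean` (which see for the scheme-level statements and the refuted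
strengthenings). This file declares NO definition — the cusp algebra is written
`Algebra.adjoin k {T², T³} ⊆ k[T]` inline — and nothing here mentions a route decl.

* `awayMap_bijective_of_forall_mul_mem` — if `φ : R → S` is injective and `s · φ r ∈ φ(R)` for
  every `s ∈ S` (`r` in the conductor), then `R[1/r] → S[1/φ r]` is bijective (used with Mathlib's
  `SpecMapRestrictBasicOpenIso` to see that `Spec φ` is an isomorphism over `D(r)`).
* `coeff_one_eq_zero_of_mem` / `mem_of_coeff_one_eq_zero` — `k[T², T³] = {f : f has no linear
  term}`; hence `X_not_mem` (`T ∉`), `mul_X_sq_mem` (`T² · k[T] ⊆ k[T², T³]`).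
* `not_isIntegrallyClosed`, `not_isRegularRing` — `k[T², T³]` is not normal (`(T²)² ∣ (T³)²` but
  `T² ∤ T³`, against `IsIntegrallyClosed.pow_dvd_pow_iff`), hence not regular (regular local rings
  are normal — Matsumura 19.4, in tree as `isIntegrallyClosed_of_isRegularLocalRing` — and
  normality is local, `IsIntegrallyClosed.of_localization_maximal`).
* `finiteType`, `isNoetherianRing`, `isIntegral_X`, `algebra_isIntegral`, `module_finite` —
  `k[T², T³]` is of finite type over `k`; `k[T]` is finite over it.
* `comap_injective` — `Spec k[T] → Spec k[T², T³]` is injective on points (`(T)` is the only prime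
  over the cusp; away from it the conductor argument identifies primes).

## Sources
* H. Matsumura, *Commutative Ring Theory*, CUP 1986, Thm. 19.4 (regular local ⇒ normal).
* The Stacks Project, Tag 037B (normal rings: normality is local), Tag 0C1S-type examples: the
  cusp `k[t², t³] ⊂ k[t]`, conductor `(t²)`.
* R. Hartshorne, *Algebraic Geometry*, GTM 52, I Ex. 3.2 (the cuspidal cubic).
-/

noncomputable section

-- single-problem summit: the doubled namespace component `ResolutionOfSingularities` is forced
set_option linter.dupNamespace false

open Polynomial
open Literature.AlgebraicGeometry.Resolution (isIntegrallyClosed_of_isRegularLocalRing)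

namespace Summit.ResolutionOfSingularities.ResolutionOfSingularities.Theorems.WildQuotientResolution.Negative

/-! ### A. Localization away from an element of the conductor is an isomorphism -/

/-- If `φ : R → S` is injective and `s · φ r ∈ φ(R)` for every `s ∈ S` (i.e. `r` lies in the
conductor of `S` into `R`), then `R[1/r] → S[1/φ r]` is bijective. [folklore] -/
theorem awayMap_bijective_of_forall_mul_mem {R S : Type*} [CommRing R] [CommRing S]
    (φ : R →+* S) (hinj : Function.Injective φ) (r : R)
    (habs : ∀ s : S, ∃ a : R, φ a = s * φ r) :
    Function.Bijective (Localization.awayMap φ r) := by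
  let T := Localization.Away (φ r)
  letI : Algebra R T := ((algebraMap S T).comp φ).toAlgebra
  have halg : ∀ a : R, algebraMap R T a = algebraMap S T (φ a) := fun _ => rfl
  haveI : IsLocalization.Away r T := by
    refine IsLocalization.Away.mk r ?_ ?_ ?_
    · rw [halg]
      exact IsLocalization.Away.algebraMap_isUnit (φ r)
    · intro z
      obtain ⟨⟨s, ⟨_, n, rfl⟩⟩, hz⟩ := IsLocalization.surj (Submonoid.powers (φ r)) z
      simp only at hz
      obtain ⟨a, ha⟩ := habs s
      refine ⟨n + 1, a, ?_⟩
      rw [halg, halg, ha, map_mul, pow_succ, ← mul_assoc, ← map_pow, hz]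
    · intro a b hab
      rw [halg, halg] at hab
      obtain ⟨⟨_, n, rfl⟩, hn⟩ := IsLocalization.exists_of_eq (M := Submonoid.powers (φ r)) hab
      refine ⟨n, hinj ?_⟩
      simpa only [map_mul, map_pow] using hn
  have heq : Localization.awayMap φ r =
      (IsLocalization.algEquiv (Submonoid.powers r) (Localization.Away r) T).toRingHom := by
    apply IsLocalization.ringHom_ext (Submonoid.powers r)
    rw [Localization.awayMap, IsLocalization.Away.map, IsLocalization.map_comp]
    ext a
    change algebraMap S T (φ a) =
      IsLocalization.algEquiv (Submonoid.powers r) (Localization.Away r) T (algebraMap R _ a)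
    rw [AlgEquiv.commutes]
    rfl
  rw [heq]
  exact (IsLocalization.algEquiv (Submonoid.powers r) (Localization.Away r) T).bijective

/-! ### B. The cusp algebra `k[T², T³] ⊆ k[T]` -/

variable (k : Type) [Field k]

/-- Elements of `k[T², T³]` have no linear term. -/
theorem coeff_one_eq_zero_of_mem {f : k[X]}
    (hf : f ∈ Algebra.adjoin k ({X ^ 2, X ^ 3} : Set k[X])) : f.coeff 1 = 0 := by
  induction hf using Algebra.adjoin_induction with
  | mem x hx =>
    rcases hx with rfl | rfl <;> simp [coeff_X_pow]
  | algebraMap r => simp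
  | add x y _ _ hx hy => simp [hx, hy]
  | mul x y hx' hy' hx hy =>
    have h0 : (x * y).coeff 1 = x.coeff 0 * y.coeff 1 + x.coeff 1 * y.coeff 0 := by
      rw [coeff_mul, Finset.Nat.antidiagonal_succ]
      simp
    rw [h0, hx, hy]; ring

/-- `T ∉ k[T², T³]`. -/
theorem X_not_mem : (X : k[X]) ∉ Algebra.adjoin k ({X ^ 2, X ^ 3} : Set k[X]) := fun h => by
  simpa using coeff_one_eq_zero_of_mem k h

/-- `T² ∈ k[T², T³]`. -/
theorem X_sq_mem : (X ^ 2 : k[X]) ∈ Algebra.adjoin k ({X ^ 2, X ^ 3} : Set k[X]) :=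
  Algebra.subset_adjoin (by simp)

/-- `T³ ∈ k[T², T³]`. -/
theorem X_cube_mem : (X ^ 3 : k[X]) ∈ Algebra.adjoin k ({X ^ 2, X ^ 3} : Set k[X]) :=
  Algebra.subset_adjoin (by simp)

/-- `T^{n+2}, T^{n+3} ∈ k[T², T³]`. -/
theorem X_pow_add_two_mem (n : ℕ) :
    (X ^ (n + 2) : k[X]) ∈ Algebra.adjoin k ({X ^ 2, X ^ 3} : Set k[X]) ∧
      (X ^ (n + 3) : k[X]) ∈ Algebra.adjoin k ({X ^ 2, X ^ 3} : Set k[X]) := by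
  induction n with
  | zero => exact ⟨X_sq_mem k, X_cube_mem k⟩
  | succ n ih =>
    refine ⟨ih.2, ?_⟩
    have : (X ^ (n + 1 + 3) : k[X]) = X ^ 2 * X ^ (n + 2) := by ring
    rw [this]
    exact Subalgebra.mul_mem _ (X_sq_mem k) ih.1

/-- Conversely, a polynomial with no linear term lies in `k[T², T³]`. -/
theorem mem_of_coeff_one_eq_zero {f : k[X]} (hf : f.coeff 1 = 0) :
    f ∈ Algebra.adjoin k ({X ^ 2, X ^ 3} : Set k[X]) := by
  rw [f.as_sum_range_C_mul_X_pow]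
  refine Subalgebra.sum_mem _ fun i _ => ?_
  rcases i with _ | _ | i
  · rw [pow_zero, mul_one, C_eq_algebraMap]
    exact Subalgebra.algebraMap_mem _ _
  · simp [hf]
  · rw [← Polynomial.smul_eq_C_mul]
    exact Subalgebra.smul_mem _ (X_pow_add_two_mem k i).1 _

/-- `g · T² ∈ k[T², T³]` for every `g ∈ k[T]`: `T²` lies in the conductor. -/
theorem mul_X_sq_mem (g : k[X]) : g * X ^ 2 ∈ Algebra.adjoin k ({X ^ 2, X ^ 3} : Set k[X]) :=
  mem_of_coeff_one_eq_zero k (by simp [coeff_mul_X_pow'])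

/-- `k[T², T³]` is not integrally closed (`T = T³/T²` is integral and missing): here via
`(T²)² ∣ (T³)²` but `T² ∤ T³`. -/
theorem not_isIntegrallyClosed :
    ¬ IsIntegrallyClosed (Algebra.adjoin k ({X ^ 2, X ^ 3} : Set k[X])) := by
  intro h
  set A := Algebra.adjoin k ({X ^ 2, X ^ 3} : Set k[X])
  let a : A := ⟨X ^ 2, X_sq_mem k⟩
  let b : A := ⟨X ^ 3, X_cube_mem k⟩
  have h1 : a ^ 2 ∣ b ^ 2 := ⟨a, Subtype.ext (by simp [a, b]; ring)⟩
  have h2 : a ∣ b := (IsIntegrallyClosed.pow_dvd_pow_iff (n := 2) two_ne_zero).mp h1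
  obtain ⟨c, hc⟩ := h2
  have hc' : (X ^ 3 : k[X]) = X ^ 2 * (c : k[X]) := congrArg Subtype.val hc
  have hX : (c : k[X]) = X := by
    have : (X ^ 2 : k[X]) * (c : k[X]) = X ^ 2 * X := by rw [← hc']; ring
    exact mul_left_cancel₀ (pow_ne_zero 2 X_ne_zero) this
  have hc2 := c.2
  rw [hX] at hc2
  exact X_not_mem k hc2

/-- Hence `k[T², T³]` is not a regular ring (regular local rings are normal — Matsumura 19.4, in
tree — and normality is local). -/
theorem not_isRegularRing :
    ¬ IsRegularRing (Algebra.adjoin k ({X ^ 2, X ^ 3} : Set k[X])) := by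
  intro h
  refine not_isIntegrallyClosed k (IsIntegrallyClosed.of_localization_maximal fun p _ hp => ?_)
  exact isIntegrallyClosed_of_isRegularLocalRing _

/-- `k[T², T³]` is of finite type over `k`, hence Noetherian. -/
theorem finiteType : Algebra.FiniteType k (Algebra.adjoin k ({X ^ 2, X ^ 3} : Set k[X])) := by
  rw [← Subalgebra.fg_iff_finiteType, Subalgebra.fg_def]
  exact ⟨{X ^ 2, X ^ 3}, Set.toFinite _, rfl⟩

/-- `k[T², T³]` is Noetherian. -/
theorem isNoetherianRing : IsNoetherianRing (Algebra.adjoin k ({X ^ 2, X ^ 3} : Set k[X])) :=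
  haveI := finiteType k
  Algebra.FiniteType.isNoetherianRing k _

/-- `T` is integral over `k[T², T³]`, so `k[T]` is integral over it. -/
theorem isIntegral_X :
    IsIntegral (Algebra.adjoin k ({X ^ 2, X ^ 3} : Set k[X])) (X : k[X]) := by
  refine IsIntegral.of_pow two_pos ?_
  have : (X ^ 2 : k[X]) = algebraMap (Algebra.adjoin k ({X ^ 2, X ^ 3} : Set k[X])) k[X]
      ⟨X ^ 2, X_sq_mem k⟩ := rfl
  rw [this]
  exact isIntegral_algebraMap

/-- `k[T]` is integral over `k[T², T³]`. -/
theorem algebra_isIntegral :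
    Algebra.IsIntegral (Algebra.adjoin k ({X ^ 2, X ^ 3} : Set k[X])) k[X] := by
  refine ⟨fun f => ?_⟩
  induction f using Polynomial.induction_on' with
  | add p q hp hq => exact hp.add hq
  | monomial n c =>
    rw [← C_mul_X_pow_eq_monomial]
    refine IsIntegral.mul ?_ ((isIntegral_X k).pow n)
    have : (C c : k[X]) = algebraMap (Algebra.adjoin k ({X ^ 2, X ^ 3} : Set k[X])) k[X]
        (algebraMap k _ c) := rfl
    rw [this]
    exact isIntegral_algebraMap

/-- `k[T]` is a finite `k[T², T³]`-module. -/
theorem module_finite : Module.Finite (Algebra.adjoin k ({X ^ 2, X ^ 3} : Set k[X])) k[X] := by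
  haveI := algebra_isIntegral k
  haveI : Algebra.FiniteType (Algebra.adjoin k ({X ^ 2, X ^ 3} : Set k[X])) k[X] :=
    Algebra.FiniteType.of_restrictScalars_finiteType k _ _
  exact Algebra.IsIntegral.finite

/-- Two primes of `k[T]` with the same contraction to `k[T², T³]` are equal (the normalisation of
the cusp is a bijection on points). -/
theorem comap_injective :
    Function.Injective (PrimeSpectrum.comap
      (algebraMap (Algebra.adjoin k ({X ^ 2, X ^ 3} : Set k[X])) k[X])) := by
  set A := Algebra.adjoin k ({X ^ 2, X ^ 3} : Set k[X])
  -- key: `f ∈ P ↔ X² f ∈ P.comap` unless `X ∈ P`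
  have key : ∀ (P Q : PrimeSpectrum k[X]),
      PrimeSpectrum.comap (algebraMap A k[X]) P = PrimeSpectrum.comap (algebraMap A k[X]) Q →
      (X : k[X]) ∉ Q.asIdeal → P.asIdeal ≤ Q.asIdeal := by
    intro P Q hPQ hXQ f hf
    have h1 : (⟨f * X ^ 2, mul_X_sq_mem k f⟩ : A) ∈
        (PrimeSpectrum.comap (algebraMap A k[X]) P).asIdeal := by
      show f * X ^ 2 ∈ P.asIdeal
      exact P.asIdeal.mul_mem_right _ hf
    rw [hPQ] at h1
    have h2 : f * X ^ 2 ∈ Q.asIdeal := h1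
    rcases Q.isPrime.mem_or_mem h2 with h | h
    · exact h
    · exact absurd (Q.isPrime.mem_of_pow_mem 2 h) hXQ
  have hXiff : ∀ (P Q : PrimeSpectrum k[X]),
      PrimeSpectrum.comap (algebraMap A k[X]) P = PrimeSpectrum.comap (algebraMap A k[X]) Q →
      (X : k[X]) ∈ P.asIdeal → (X : k[X]) ∈ Q.asIdeal := by
    intro P Q hPQ hXP
    have h1 : (⟨X ^ 2, X_sq_mem k⟩ : A) ∈ (PrimeSpectrum.comap (algebraMap A k[X]) P).asIdeal := by
      show (X : k[X]) ^ 2 ∈ P.asIdeal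
      exact P.asIdeal.pow_mem_of_mem hXP 2 two_pos
    rw [hPQ] at h1
    exact Q.isPrime.mem_of_pow_mem 2 h1
  have hmax : (Ideal.span {(X : k[X])}).IsMaximal := by
    rw [← Polynomial.ker_constantCoeff]
    exact RingHom.ker_isMaximal_of_surjective _ (fun c => ⟨C c, by simp⟩)
  have hXmem : ∀ P : PrimeSpectrum k[X], (X : k[X]) ∈ P.asIdeal → P.asIdeal = Ideal.span {X} := by
    intro P hXP
    exact (hmax.eq_of_le P.isPrime.ne_top ((Ideal.span_singleton_le_iff_mem _).mpr hXP)).symm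
  intro P Q hPQ
  ext1
  by_cases hXP : (X : k[X]) ∈ P.asIdeal
  · rw [hXmem P hXP, hXmem Q (hXiff P Q hPQ hXP)]
  · have hXQ : (X : k[X]) ∉ Q.asIdeal := fun h => hXP (hXiff Q P hPQ.symm h)
    exact le_antisymm (key P Q hPQ hXQ) (key Q P hPQ.symm hXP)


end Summit.ResolutionOfSingularities.ResolutionOfSingularities.Theorems.WildQuotientResolution.Negative

end
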